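import Mathlib
import Summits.FinalStateConjecture.FinalStateConjecture.Theorems.PhotonSphereChannelsUniformPhotonSphereChannelsRPeelHardy

/-!
# Peeling, file 8: qualitative tools for the recessive static mode `u'' = Q u`, `Q ≥ 0`

Support file for `stub_peel` of the line `crum-peeling-recessive-tower` (crux
`UniformPhotonSphereChannelsR`, stmt-FinalStateConjecture-14074).  For a solution `u` of
`u'' = Q u` on `(a, ∞)` with `Q ≥ 0` there:

* `mul_deriv_nonpos_of_growth` — if `u(x)² ≤ K √x` far out then `u u' ≤ 0` on `(a, ∞)`
  (`(u u')' = u'² + Q u² ≥ 0`, so a positive value of `u u'` would force `u² ≳ x`);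
* `static_package` — if moreover `u > 0` and `u' ≤ 0` on `(a, ∞)` then, for an edge `xf > a`:
  `u ≤ u(xf)` on `[xf, ∞)`, `|u'(x)| ≤ u(xf)/(x − xf)` (convexity), and the static energy
  `u'² + Q u²` is integrable on `(xf, ∞)` with `∫ ≤ −u(xf) u'(xf)`.
-/

noncomputable section

-- the doubled `FinalStateConjecture` component is the tree's fixed summit/problem path
set_option linter.dupNamespace false

namespace Summit.FinalStateConjecture.FinalStateConjecture.Theorems.CrumPeelingRecessiveTower

open MeasureTheory Set Filter Topology intervalIntegral

/-- **No growing branch.**  Let `u' = du`, `du' = Q u` on `(a, ∞)` with `Q ≥ 0`, and suppose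
`u(x)² ≤ K x^{1/2}` for `x ≥ X₂`.  Then `u(x) u'(x) ≤ 0` for every `x > a`. -/
theorem mul_deriv_nonpos_of_growth {u du Q : ℝ → ℝ} {a K X₂ : ℝ}
    (hu : ∀ x, a < x → HasDerivAt u (du x) x) (hdu : ∀ x, a < x → HasDerivAt du (Q x * u x) x)
    (hQ0 : ∀ x, a < x → 0 ≤ Q x) (hgrowth : ∀ x, X₂ ≤ x → u x ^ 2 ≤ K * x ^ ((1 : ℝ) / 2)) :
    ∀ x, a < x → u x * du x ≤ 0 := by
  -- `F = u u'` is non-decreasing on `(a, ∞)`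
  set F : ℝ → ℝ := fun x => u x * du x with hF
  have hFd : ∀ x, a < x → HasDerivAt F (du x * du x + u x * (Q x * u x)) x := fun x hx =>
    (hu x hx).mul (hdu x hx)
  have hFmono : MonotoneOn F (Ioi a) := by
    refine monotoneOn_of_deriv_nonneg (convex_Ioi a)
      (fun x hx => (hFd x hx).continuousAt.continuousWithinAt)
      (fun x hx => (hFd x (interior_subset hx)).differentiableAt.differentiableWithinAt)
      fun x hx => ?_
    rw [interior_Ioi] at hx
    rw [(hFd x hx).deriv]
    have := hQ0 x hx
    nlinarith [sq_nonneg (du x), sq_nonneg (u x)]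
  intro x₀ hx₀
  by_contra hpos
  push Not at hpos
  set m : ℝ := u x₀ * du x₀ with hm
  have hm0 : 0 < m := hpos
  -- `g = u² − 2 m x` is non-decreasing on `[x₀, ∞)`
  set g : ℝ → ℝ := fun x => u x ^ 2 - 2 * m * x with hg
  have hgd : ∀ x, a < x → HasDerivAt g (↑2 * u x ^ (2 - 1) * du x - 2 * m * 1) x := fun x hx =>
    ((hu x hx).pow 2).sub ((hasDerivAt_id x).const_mul (2 * m))
  have hgmono : MonotoneOn g (Ici x₀) := by
    refine monotoneOn_of_deriv_nonneg (convex_Ici x₀)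
      (fun x hx => (hgd x (hx₀.trans_le hx)).continuousAt.continuousWithinAt)
      (fun x hx => (hgd x (hx₀.trans_le (interior_subset hx))).differentiableAt.differentiableWithinAt)
      fun x hx => ?_
    rw [interior_Ici] at hx
    rw [(hgd x (hx₀.trans hx)).deriv]
    have hFx : m ≤ F x := hFmono (show a < x₀ from hx₀) (show a < x from hx₀.trans hx) hx.le
    simp only [hF] at hFx
    simp only [Nat.add_one_sub_one, pow_one, mul_one]
    nlinarith
  -- a far point where the growth bound is violated
  have hK : 0 ≤ K := by
    by_contra hK
    push Not at hK
    set y : ℝ := max X₂ 1 with hy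
    have h := hgrowth y (le_max_left _ _)
    have hy0 : 0 < y := lt_of_lt_of_le one_pos (le_max_right _ _)
    have : K * y ^ ((1 : ℝ) / 2) < 0 := mul_neg_of_neg_of_pos hK (Real.rpow_pos_of_pos hy0 _)
    nlinarith [sq_nonneg (u y)]
  set x : ℝ := max (max (2 * x₀) (max X₂ 1)) ((K / m) ^ 2 + 2 * |x₀| + 1) with hx
  have hx1 : 1 ≤ x := le_trans (le_max_right _ _) (le_trans (le_max_right _ _) (le_max_left _ _))
  have hx0 : 0 < x := by linarith
  have hxX₂ : X₂ ≤ x := le_trans (le_max_left _ _) (le_trans (le_max_right _ _) (le_max_left _ _))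
  have hxx₀ : x₀ ≤ x := by
    have : 2 * x₀ ≤ x := le_trans (le_max_left _ _) (le_max_left _ _)
    have : (K / m) ^ 2 + 2 * |x₀| + 1 ≤ x := le_max_right _ _
    cases le_or_gt 0 x₀ with
    | inl h => linarith
    | inr h => linarith [abs_nonneg x₀]
  have hhalf : x / 2 ≤ x - x₀ := by
    have : 2 * x₀ ≤ x := le_trans (le_max_left _ _) (le_max_left _ _)
    linarith
  have hbig : (K / m) ^ 2 < x := by
    have : (K / m) ^ 2 + 2 * |x₀| + 1 ≤ x := le_max_right _ _
    linarith [abs_nonneg x₀]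
  -- `u(x)² ≥ 2 m (x − x₀) ≥ m x` but `u(x)² ≤ K √x < m x`
  have hlow : m * x ≤ u x ^ 2 := by
    have h := hgmono (show x₀ ≤ x₀ from le_rfl) hxx₀ hxx₀
    simp only [hg] at h
    nlinarith [sq_nonneg (u x₀)]
  have hup : u x ^ 2 ≤ K * x ^ ((1 : ℝ) / 2) := hgrowth x hxX₂
  have hsqrt : K * x ^ ((1 : ℝ) / 2) < m * x := by
    have hs0 : 0 < x ^ ((1 : ℝ) / 2) := Real.rpow_pos_of_pos hx0 _
    have hs : x ^ ((1 : ℝ) / 2) * x ^ ((1 : ℝ) / 2) = x := by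
      rw [← Real.rpow_add hx0]; norm_num
    -- `K < m √x` since `(K/m)² < x = (√x)²`
    have h1 : K / m < x ^ ((1 : ℝ) / 2) := by
      by_contra hle
      push Not at hle
      have hKm : 0 ≤ K / m := div_nonneg hK hm0.le
      have : x ≤ (K / m) ^ 2 := by
        calc x = x ^ ((1 : ℝ) / 2) * x ^ ((1 : ℝ) / 2) := hs.symm
          _ ≤ (K / m) * (K / m) := mul_le_mul hle hle hs0.le hKm
          _ = (K / m) ^ 2 := by ring
      linarith
    have h2 : K < m * x ^ ((1 : ℝ) / 2) := by
      rw [div_lt_iff₀ hm0] at h1; linarith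
    calc K * x ^ ((1 : ℝ) / 2) < (m * x ^ ((1 : ℝ) / 2)) * x ^ ((1 : ℝ) / 2) :=
          mul_lt_mul_of_pos_right h2 hs0
      _ = m * x := by rw [mul_assoc, hs]
  linarith

/-- **The convex, decreasing, positive static mode.**  Let `u' = du`, `du' = Q u` on `(a, ∞)`
with `Q ≥ 0`, `u > 0` and `du ≤ 0` there, and let `xf > a`.  Then `u ≤ u(xf)` on `[xf, ∞)`,
`|u'(x)| ≤ u(xf)/(x − xf)` for `x > xf`, and `u'² + Q u²`, `u'²`, `Q u²` are integrable on
`(xf, ∞)`. -/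
theorem static_package {u du Q : ℝ → ℝ} {a xf : ℝ} (haxf : a < xf)
    (hu : ∀ x, a < x → HasDerivAt u (du x) x) (hdu : ∀ x, a < x → HasDerivAt du (Q x * u x) x)
    (hQc : ContinuousOn Q (Ioi a)) (hQ0 : ∀ x, a < x → 0 ≤ Q x) (hpos : ∀ x, a < x → 0 < u x)
    (hneg : ∀ x, a < x → du x ≤ 0) :
    (∀ x, xf ≤ x → u x ≤ u xf) ∧ (∀ x, xf < x → |du x| ≤ u xf / (x - xf)) ∧
    IntegrableOn (fun x => du x ^ 2 + Q x * u x ^ 2) (Ioi xf) ∧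
    IntegrableOn (fun x => du x ^ 2) (Ioi xf) ∧ IntegrableOn (fun x => Q x * u x ^ 2) (Ioi xf) := by
  have huc : ContinuousOn u (Ioi a) := fun x hx => (hu x hx).continuousAt.continuousWithinAt
  have hduc : ContinuousOn du (Ioi a) := fun x hx => (hdu x hx).continuousAt.continuousWithinAt
  -- `u` is non-increasing, `du` is non-decreasing on `(a, ∞)`
  have huanti : AntitoneOn u (Ioi a) := by
    refine antitoneOn_of_deriv_nonpos (convex_Ioi a) huc
      (fun x hx => (hu x (interior_subset hx)).differentiableAt.differentiableWithinAt) fun x hx => ?_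
    rw [interior_Ioi] at hx
    rw [(hu x hx).deriv]; exact hneg x hx
  have hdumono : MonotoneOn du (Ioi a) := by
    refine monotoneOn_of_deriv_nonneg (convex_Ioi a) hduc
      (fun x hx => (hdu x (interior_subset hx)).differentiableAt.differentiableWithinAt) fun x hx => ?_
    rw [interior_Ioi] at hx
    rw [(hdu x hx).deriv]; exact mul_nonneg (hQ0 x hx) (hpos x hx).le
  have hle : ∀ x, xf ≤ x → u x ≤ u xf := fun x hx => huanti haxf (haxf.trans_le hx) hx
  -- the derivative bound from convexity
  have hderiv : ∀ x, xf < x → |du x| ≤ u xf / (x - xf) := by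
    intro x hx
    have hxa : a < x := haxf.trans hx
    have hsub : ∀ s ∈ uIcc xf x, a < s := fun s hs => by
      rw [uIcc_of_le hx.le] at hs; exact haxf.trans_le hs.1
    have hftc : ∫ s in xf..x, du s = u x - u xf :=
      integral_eq_sub_of_hasDerivAt (fun s hs => hu s (hsub s hs))
        ((hduc.mono fun s hs => hsub s (by rw [uIcc_of_le hx.le]; exact hs)).intervalIntegrable_of_Icc
          hx.le)
    have hmono : ∫ s in xf..x, du s ≤ ∫ s in xf..x, du x := by
      refine intervalIntegral.integral_mono_on hx.le ?_ ?_ fun s hs => ?_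
      · exact (hduc.mono fun s hs => haxf.trans_le hs.1).intervalIntegrable_of_Icc hx.le
      · exact intervalIntegrable_const
      · exact hdumono (show a < s from haxf.trans_le hs.1) (show a < x from hxa) hs.2
    rw [intervalIntegral.integral_const, smul_eq_mul, hftc] at hmono
    have hupos := hpos x hxa
    rw [abs_of_nonpos (hneg x hxa), le_div_iff₀ (sub_pos.2 hx)]
    nlinarith
  -- the energy: bounded partial integrals of `(u du)' = du² + Q u²`
  set F : ℝ → ℝ := fun x => u x * du x with hF
  have hFd : ∀ x, a < x → HasDerivAt F (du x * du x + u x * (Q x * u x)) x := fun x hx =>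
    (hu x hx).mul (hdu x hx)
  set e : ℝ → ℝ := fun x => du x ^ 2 + Q x * u x ^ 2 with he
  have hec : ContinuousOn e (Ioi a) := (hduc.pow 2).add (hQc.mul (huc.pow 2))
  have he0 : ∀ x, a < x → 0 ≤ e x := fun x hx => by
    have := hQ0 x hx; simp only [he]; positivity
  have hint : ∀ Y, xf ≤ Y → ∫ x in xf..Y, e x ≤ -F xf := by
    intro Y hY
    have hsub : ∀ s ∈ uIcc xf Y, a < s := fun s hs => by
      rw [uIcc_of_le hY] at hs; exact haxf.trans_le hs.1
    have hftc : ∫ x in xf..Y, e x = F Y - F xf := by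
      have h := integral_eq_sub_of_hasDerivAt (fun s hs => hFd s (hsub s hs))
        (((hduc.mul hduc).add (huc.mul (hQc.mul huc))).mono (fun s hs => hsub s
          (by rw [uIcc_of_le hY]; exact hs)) |>.intervalIntegrable_of_Icc hY)
      rw [← h]
      refine intervalIntegral.integral_congr fun s _ => ?_
      simp only [he]; ring
    have hFY : F Y ≤ 0 := by
      simp only [hF]
      exact mul_nonpos_of_nonneg_of_nonpos (hpos Y (haxf.trans_le hY)).le (hneg Y (haxf.trans_le hY))
    linarith
  have hI : IntegrableOn e (Ioi xf) := by
    refine integrableOn_Ioi_of_intervalIntegral_norm_bounded (-F xf) xf (l := atTop) (b := id)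
      (fun Y => ?_) tendsto_id ?_
    · exact ((hec.mono fun x hx => haxf.trans_le hx.1).integrableOn_compact isCompact_Icc).mono_set
        Ioc_subset_Icc_self
    · filter_upwards [Filter.eventually_ge_atTop xf] with Y hY
      have : ∫ x in xf..id Y, ‖e x‖ = ∫ x in xf..Y, e x :=
        intervalIntegral.integral_congr fun x hx => by
          have hx' : x ∈ uIcc xf Y := hx
          rw [uIcc_of_le hY] at hx'
          rw [Real.norm_eq_abs, abs_of_nonneg (he0 x (haxf.trans_le hx'.1))]
      rw [this]
      exact hint Y hY
  have hm1 : AEStronglyMeasurable (fun x => du x ^ 2) (volume.restrict (Ioi xf)) :=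
    ((hduc.pow 2).mono (Ioi_subset_Ioi haxf.le)).aestronglyMeasurable measurableSet_Ioi
  have hm2 : AEStronglyMeasurable (fun x => Q x * u x ^ 2) (volume.restrict (Ioi xf)) :=
    ((hQc.mul (huc.pow 2)).mono (Ioi_subset_Ioi haxf.le)).aestronglyMeasurable measurableSet_Ioi
  have hI1 : IntegrableOn (fun x => du x ^ 2) (Ioi xf) := by
    refine hI.mono' hm1 ?_
    filter_upwards [ae_restrict_mem measurableSet_Ioi] with x hx
    have := hQ0 x (haxf.trans hx)
    rw [Real.norm_eq_abs, abs_of_nonneg (sq_nonneg _)]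
    simp only [he]
    nlinarith [sq_nonneg (u x)]
  have hI2 : IntegrableOn (fun x => Q x * u x ^ 2) (Ioi xf) := by
    refine hI.mono' hm2 ?_
    filter_upwards [ae_restrict_mem measurableSet_Ioi] with x hx
    have := hQ0 x (haxf.trans hx)
    rw [Real.norm_eq_abs, abs_of_nonneg (by positivity)]
    simp only [he]
    nlinarith [sq_nonneg (du x)]
  exact ⟨hle, hderiv, hI, hI1, hI2⟩

/-- Registered sub-goal `peel_noGrowingBranch` of `stub_peel` (verbatim signature): a solution of `u'' = Q u`, `Q ≥ 0`, growing slower than `x^{1/4}` has `u u' ≤ 0`. -/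
theorem peel_noGrowingBranch : ∀ (u du Q : ℝ → ℝ) (a K X₂ : ℝ), (∀ x, a < x → HasDerivAt u (du x) x) → (∀ x, a < x → HasDerivAt du (Q x * u x) x) → (∀ x, a < x → 0 ≤ Q x) → (∀ x, X₂ ≤ x → u x ^ 2 ≤ K * x ^ ((1 : ℝ) / 2)) → ∀ x : ℝ, a < x → u x * du x ≤ 0 :=
  fun _ _ _ _ _ _ hu hdu hQ0 hg => mul_deriv_nonpos_of_growth hu hdu hQ0 hg

end Summit.FinalStateConjecture.FinalStateConjecture.Theorems.CrumPeelingRecessiveTower
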